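import Mathlib.Analysis.SpecialFunctions.Pow.NthRootLemmas
import Mathlib.Analysis.Asymptotics.Lemmas
import Literature.Computability.Complexity.HashBricks
import Literature.Computability.Complexity.StackBricksArith
import Literature.Computability.Complexity.NSubexp
import HarnessLib

/-!
# Smooth quasi-polynomial time bounds `2^{(log n)^{E+1}}` without ceilings

Literature / complexity toolkit, serving the decomposition of Murray–Williams' connection
"`2^{n - n^ε}`-time `ACC`-SAT ⟹ `NQP ⊄ ACC`" (`MurrayWilliams2018Transfer.lean`). That proof
feeds a quasi-polynomial level `t(n) = 2^{log^{E+1} n}` to the nondeterministic time hierarchy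
theorem in the form `f(n + 1) = o(t(n))` (Seiferas–Fischer–Meyer 1978, Žák 1983; Arora–Barak
2009, Thm. 3.2). With the tree's integer logarithm `Nat.log 2` the literal level
`n ↦ 2 ^ (Nat.log 2 n) ^ (E + 1)` is a STEP function jumping by the factor
`2^{(j+1)^{E+1} - j^{E+1}}` at `n = 2ʲ`, so that no `f` within a quasi-polynomial factor of it
satisfies `f(n + 1) = o(t(n))`; the real-valued bound of the source (Murray–Williams 2018, §2:
"all logarithms are base-2 with ceilings as appropriate") has no such jumps. This file supplies
an integer-valued SMOOTH version and everything the assembly needs about it, all proved: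

* `qpExp E n` — the exponent: for `n = 2ʲ + s`, `0 ≤ s < 2ʲ`,
  `qpExp E n = j + 1 + j^{E+1} + ⌊s · ((j+1)^{E+1} - j^{E+1}) / 2ʲ⌋`, the linear interpolation
  of `j ↦ j^{E+1}` between consecutive powers of two, plus `j + 1` (so that `2^{qpExp E n} > n`);
* `smoothQP E n = 2 ^ qpExp E n` (the level `g`) and `smoothQPSim E n = 2 ^ (qpExp E n - j²)`
  (the faster bound `f` reached by the simulation, a factor `2^{(log₂ n)²}` below `g`);
* arithmetic: `log_smoothQP` (`log₂ g = qpExp`), the sandwich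
  `j + 1 + j^{E+1} ≤ qpExp E n ≤ j + 1 + (j+1)^{E+1}` (`qpExp_ge`, `qpExp_le`), `n < g n`,
  `n < f n`, domination of every polynomial (`exists_poly_le_smoothQP`, `exists_poly_le_smoothQPSim`),
  the upper sandwich by the tree's level `n ^ (log₂ n) ^ (E + 2)`
  (`exists_smoothQP_mul_pow_le`), the growth of `log₂ g` (`eventually_mul_log_pow_le_log_smoothQP`),
  the savings inequality `g · (log₂ g)ᵇ ≤ f · 2^{⌊(log₂ g)^{1/r}⌋}` eventually when `3r ≤ E + 1`
  (`eventually_smoothQP_mul_log_pow_le`), smoothness `qpExp E (n+1) ≤ qpExp E n + 2` eventually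
  (`eventually_qpExp_succ_le`) and **`f(n + 1) = o(g(n))`** (`isLittleO_smoothQPSim_succ`);
* machines: `1ⁿ ↦ bin (g n)` and `1ⁿ ↦ bin (f n)` are polynomial-time (`polyTimeComputable_smoothQP`,
  `polyTimeComputable_smoothQPSim`), assembled from the tree's `FP` bricks (`popCountFn`,
  `onesFn`, `addFn`, `subFn`, `prodFn`, `divFn`, `modExpFn`, `powFn`; the power `2^{qpExp}` is a
  modular power below the modulus `2 · 2^{2 n^{E+1}} + 1`), hence **both bounds are time
  constructible** in the tree's Sipser form (`isTimeConstructible_smoothQP`,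
  `isTimeConstructible_smoothQPSim`; Arora–Barak 2009, §1.3).

No machine is written by hand; Mathlib has no time-constructibility notion (the tree's
`IsTimeConstructible`, `FP` and bricks are reused; Mathlib's `Nat.log`, `Nat.nthRoot`,
`Asymptotics.IsLittleO` are used).

## References

* C. D. Murray, R. R. Williams, *Circuit lower bounds for nondeterministic quasi-polytime: an
  easy witness lemma for NP and NQP*, STOC 2018, §2 (conventions) and §5 (proof of Thm. 1.2:
  `t(n) = 2^{log^{ck⁴/ε} n}`, "`L ∈ NTIME[t(n)] - NTIME[t(n)/2^{log^{ε/2} t(n)}]`")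
  [MurrayWilliams2018].
* S. Arora, B. Barak, *Computational Complexity: A Modern Approach*, CUP 2009, §1.3 (p. 16,
  time-constructible functions), Thm. 3.2 (nondeterministic time hierarchy) [AroraBarakCC2009].
-/

noncomputable section

namespace Literature.Computability.Complexity

open _root_.Computability Filter Asymptotics Polynomial

/-! ### The smooth quasi-polynomial exponent and the two bounds -/

/-- The smooth quasi-polynomial exponent: with `j = log₂ n` and `s = n - 2ʲ`,
`qpExp E n = j + 1 + j^{E+1} + ⌊s · ((j+1)^{E+1} - j^{E+1}) / 2ʲ⌋` — the linear interpolation of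
`j ↦ j^{E+1}` between consecutive powers of two, shifted by `j + 1` (Murray–Williams' exponent
`log^{E+1} n` read without ceilings; the shift makes `2^{qpExp E n} > n`). [folklore] -/
def qpExp (E n : ℕ) : ℕ :=
  Nat.log 2 n + 1 + Nat.log 2 n ^ (E + 1) +
    (n - 2 ^ Nat.log 2 n) * ((Nat.log 2 n + 1) ^ (E + 1) - Nat.log 2 n ^ (E + 1)) /
      2 ^ Nat.log 2 n

/-- The smooth quasi-polynomial level `smoothQP E n = 2 ^ qpExp E n` (`≈ 2^{(log₂ n)^{E+1}}`,
Murray–Williams 2018, §5: `t(n) = 2^{log^{ck⁴/ε} n}`, without ceilings).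
[cite: MurrayWilliams2018, §5 (proof of Thm. 1.2)] -/
def smoothQP (E n : ℕ) : ℕ := 2 ^ qpExp E n

/-- The simulation bound `smoothQPSim E n = 2 ^ (qpExp E n - (log₂ n)²)`: the level `smoothQP E`
divided by `2^{(log₂ n)²}` (the role of `t(n)/2^{log^{ε/2} t(n)}` in Murray–Williams 2018, §5,
proof of Thm. 1.2). [cite: MurrayWilliams2018, §5 (proof of Thm. 1.2)] -/
def smoothQPSim (E n : ℕ) : ℕ := 2 ^ (qpExp E n - Nat.log 2 n ^ 2)

/-! ### Elementary arithmetic of the exponent -/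

/-- `s = n - 2ʲ ≤ 2ʲ` for `j = log₂ n`. [folklore] -/
theorem sub_two_pow_log_le (n : ℕ) : n - 2 ^ Nat.log 2 n ≤ 2 ^ Nat.log 2 n := by
  have h : n < 2 ^ (Nat.log 2 n + 1) := Nat.lt_pow_succ_log_self one_lt_two n
  rw [pow_succ] at h
  omega

/-- The interpolation term is at most the increment `(j+1)^{E+1} - j^{E+1}`. [folklore] -/
theorem qpExp_interp_le (E n : ℕ) :
    (n - 2 ^ Nat.log 2 n) * ((Nat.log 2 n + 1) ^ (E + 1) - Nat.log 2 n ^ (E + 1)) /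
        2 ^ Nat.log 2 n ≤
      (Nat.log 2 n + 1) ^ (E + 1) - Nat.log 2 n ^ (E + 1) := by
  set D := (Nat.log 2 n + 1) ^ (E + 1) - Nat.log 2 n ^ (E + 1)
  have hpos : 0 < 2 ^ Nat.log 2 n := Nat.two_pow_pos _
  calc (n - 2 ^ Nat.log 2 n) * D / 2 ^ Nat.log 2 n
      ≤ 2 ^ Nat.log 2 n * D / 2 ^ Nat.log 2 n :=
        Nat.div_le_div_right (Nat.mul_le_mul_right _ (sub_two_pow_log_le n))
    _ = D := by rw [Nat.mul_div_cancel_left _ hpos]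

/-- Lower sandwich: `j + 1 + j^{E+1} ≤ qpExp E n`. [folklore] -/
theorem qpExp_ge (E n : ℕ) : Nat.log 2 n + 1 + Nat.log 2 n ^ (E + 1) ≤ qpExp E n :=
  Nat.le_add_right _ _

/-- Upper sandwich: `qpExp E n ≤ j + 1 + (j+1)^{E+1}`. [folklore] -/
theorem qpExp_le (E n : ℕ) : qpExp E n ≤ Nat.log 2 n + 1 + (Nat.log 2 n + 1) ^ (E + 1) := by
  have h := qpExp_interp_le E n
  have hmono : Nat.log 2 n ^ (E + 1) ≤ (Nat.log 2 n + 1) ^ (E + 1) :=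
    Nat.pow_le_pow_left (Nat.le_succ _) _
  unfold qpExp
  omega

/-- `j^{E+1} ≤ qpExp E n`. [folklore] -/
theorem pow_log_le_qpExp (E n : ℕ) : Nat.log 2 n ^ (E + 1) ≤ qpExp E n :=
  le_trans (Nat.le_add_left _ _) (qpExp_ge E n)

/-- `j + 1 ≤ qpExp E n`. [folklore] -/
theorem log_succ_le_qpExp (E n : ℕ) : Nat.log 2 n + 1 ≤ qpExp E n :=
  le_trans (Nat.le_add_right _ _) (qpExp_ge E n)

/-- `j² ≤ j^{E+1}` for `1 ≤ E`. [folklore] -/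
theorem log_sq_le_pow_log {E : ℕ} (hE : 1 ≤ E) (n : ℕ) :
    Nat.log 2 n ^ 2 ≤ Nat.log 2 n ^ (E + 1) := by
  rcases Nat.eq_zero_or_pos (Nat.log 2 n) with h | h
  · rw [h, zero_pow two_ne_zero]; exact Nat.zero_le _
  · exact Nat.pow_le_pow_right h (by omega)

/-- `j² ≤ qpExp E n` for `1 ≤ E`. [folklore] -/
theorem log_sq_le_qpExp {E : ℕ} (hE : 1 ≤ E) (n : ℕ) : Nat.log 2 n ^ 2 ≤ qpExp E n :=
  (log_sq_le_pow_log hE n).trans (pow_log_le_qpExp E n)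

/-- `log₂ (smoothQP E n) = qpExp E n`. [folklore] -/
@[simp] theorem log_smoothQP (E n : ℕ) : Nat.log 2 (smoothQP E n) = qpExp E n :=
  Nat.log_pow one_lt_two _

/-- `n < smoothQP E n` (as `n < 2^{j+1} ≤ 2^{qpExp E n}`). [folklore] -/
theorem lt_smoothQP (E n : ℕ) : n < smoothQP E n :=
  lt_of_lt_of_le (Nat.lt_pow_succ_log_self one_lt_two n)
    (Nat.pow_le_pow_right two_pos (log_succ_le_qpExp E n))

/-- `n ≤ smoothQP E n`. [folklore] -/
theorem le_smoothQP (E n : ℕ) : n ≤ smoothQP E n := (lt_smoothQP E n).le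

/-- The exponent of the simulation bound is at least `j + 1 + (j^{E+1} - j²)`. [folklore] -/
theorem qpExp_sub_sq_ge {E : ℕ} (hE : 1 ≤ E) (n : ℕ) :
    Nat.log 2 n + 1 + (Nat.log 2 n ^ (E + 1) - Nat.log 2 n ^ 2) ≤ qpExp E n - Nat.log 2 n ^ 2 := by
  have h1 := qpExp_ge E n
  have h2 := log_sq_le_pow_log hE n
  omega

/-- `n < smoothQPSim E n` for `1 ≤ E` (as `qpExp E n - j² ≥ j + 1`). [folklore] -/
theorem lt_smoothQPSim {E : ℕ} (hE : 1 ≤ E) (n : ℕ) : n < smoothQPSim E n :=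
  lt_of_lt_of_le (Nat.lt_pow_succ_log_self one_lt_two n)
    (Nat.pow_le_pow_right two_pos (le_trans (Nat.le_add_right _ _) (qpExp_sub_sq_ge hE n)))

/-- `n ≤ smoothQPSim E n` for `1 ≤ E`. [folklore] -/
theorem le_smoothQPSim {E : ℕ} (hE : 1 ≤ E) (n : ℕ) : n ≤ smoothQPSim E n := (lt_smoothQPSim hE n).le

/-- `smoothQPSim E n ≤ smoothQP E n`. [folklore] -/
theorem smoothQPSim_le (E n : ℕ) : smoothQPSim E n ≤ smoothQP E n :=
  Nat.pow_le_pow_right two_pos (Nat.sub_le _ _)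

/-- `smoothQPSim E n * 2^{j²} = smoothQP E n` for `1 ≤ E`. [folklore] -/
theorem smoothQPSim_mul_two_pow_sq {E : ℕ} (hE : 1 ≤ E) (n : ℕ) :
    smoothQPSim E n * 2 ^ Nat.log 2 n ^ 2 = smoothQP E n := by
  rw [smoothQPSim, smoothQP, ← pow_add, Nat.sub_add_cancel (log_sq_le_qpExp hE n)]

/-- `log₂ n ≥ j₀` once `n ≥ 2^{j₀}`. [folklore] -/
theorem le_log_of_two_pow_le {j₀ n : ℕ} (h : 2 ^ j₀ ≤ n) : j₀ ≤ Nat.log 2 n :=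
  (Nat.le_log_iff_pow_le one_lt_two (by have := Nat.two_pow_pos j₀; omega)).mpr h

/-! ### Domination of polynomials (time-constructibility side condition) -/

/-- `nᵈ ≤ 2^{d²} · smoothQP E n` for `1 ≤ E`: `n < 2^{j+1}` and `(j+1)d ≤ d² + j² + j + 1`.
[folklore] -/
theorem pow_le_mul_smoothQP {E : ℕ} (hE : 1 ≤ E) (d n : ℕ) :
    n ^ d ≤ 2 ^ (d ^ 2) * smoothQP E n := by
  set j := Nat.log 2 n with hj
  have hexp : (j + 1) * d ≤ d ^ 2 + qpExp E n := by
    have h1 : (j + 1) * d ≤ d ^ 2 + (j ^ 2 + j + 1) := by nlinarith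
    have h2 : j ^ 2 + j + 1 ≤ qpExp E n := by
      have := qpExp_ge E n; have := log_sq_le_pow_log hE n; rw [← hj] at *; omega
    omega
  calc n ^ d ≤ (2 ^ (j + 1)) ^ d := Nat.pow_le_pow_left (Nat.lt_pow_succ_log_self one_lt_two n).le d
    _ = 2 ^ ((j + 1) * d) := by rw [← pow_mul]
    _ ≤ 2 ^ (d ^ 2 + qpExp E n) := Nat.pow_le_pow_right two_pos hexp
    _ = 2 ^ (d ^ 2) * smoothQP E n := by rw [pow_add, smoothQP]

/-- `nᵈ ≤ 2^{(d+1)d} · smoothQPSim E n` for `2 ≤ E`: `(j+1)d ≤ (j³ - j²) + j + 1 + (d+1)d`.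
[folklore] -/
theorem pow_le_mul_smoothQPSim {E : ℕ} (hE : 2 ≤ E) (d n : ℕ) :
    n ^ d ≤ 2 ^ ((d + 1) * d) * smoothQPSim E n := by
  set j := Nat.log 2 n with hj
  have hcube : j ^ 3 - j ^ 2 ≤ j ^ (E + 1) - j ^ 2 := by
    rcases Nat.eq_zero_or_pos j with h | h
    · simp [h]
    · exact Nat.sub_le_sub_right (Nat.pow_le_pow_right h (by omega)) _
  have hkey : (j + 1) * d + j ^ 2 ≤ j ^ 3 + (j + 1) + (d + 1) * d := by
    rcases le_or_gt j d with hjd | hjd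
    · nlinarith [Nat.mul_le_mul_right d (Nat.succ_le_succ hjd)]
    · -- `j ≥ d + 1 ≥ 1`: `(j+1) d ≤ j² - 1` and `2 j² ≤ j³ + j + 2`
      have h1 : (j + 1) * (d + 1) ≤ (j + 1) * j := Nat.mul_le_mul_left _ hjd
      rcases le_or_gt 2 j with hj2 | hj2
      · have h2 : 2 * j ^ 2 ≤ j * j ^ 2 := Nat.mul_le_mul_right _ hj2
        nlinarith [h1, h2]
      · have hj1 : j = 1 := by omega
        have hd0 : d = 0 := by omega
        subst hd0; rw [hj1]; norm_num
  have hsq3 : j ^ 2 ≤ j ^ 3 := by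
    rcases Nat.eq_zero_or_pos j with h | h
    · simp [h]
    · exact Nat.pow_le_pow_right h (by omega)
  have hexp : (j + 1) * d ≤ (d + 1) * d + (qpExp E n - j ^ 2) := by
    have := qpExp_sub_sq_ge (show 1 ≤ E by omega) n
    rw [← hj] at this
    omega
  calc n ^ d ≤ (2 ^ (j + 1)) ^ d := Nat.pow_le_pow_left (Nat.lt_pow_succ_log_self one_lt_two n).le d
    _ = 2 ^ ((j + 1) * d) := by rw [← pow_mul]
    _ ≤ 2 ^ ((d + 1) * d + (qpExp E n - j ^ 2)) := Nat.pow_le_pow_right two_pos hexp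
    _ = 2 ^ ((d + 1) * d) * smoothQPSim E n := by rw [pow_add, smoothQPSim]

/-- Every polynomial is dominated by `c · smoothQP E n + c` (`1 ≤ E`). [folklore] -/
theorem exists_poly_le_smoothQP {E : ℕ} (hE : 1 ≤ E) (p : Polynomial ℕ) :
    ∃ c : ℕ, ∀ n : ℕ, p.eval n ≤ c * smoothQP E n + c := by
  obtain ⟨c₁, d, h₁⟩ := exists_eval_le_mul_pow_add p
  refine ⟨c₁ * 2 ^ (d ^ 2) + c₁, fun n => ?_⟩
  calc p.eval n ≤ c₁ * n ^ d + c₁ := h₁ n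
    _ ≤ c₁ * (2 ^ (d ^ 2) * smoothQP E n) + c₁ := by gcongr; exact pow_le_mul_smoothQP hE d n
    _ = (c₁ * 2 ^ (d ^ 2)) * smoothQP E n + c₁ := by ring
    _ ≤ (c₁ * 2 ^ (d ^ 2) + c₁) * smoothQP E n + (c₁ * 2 ^ (d ^ 2) + c₁) := by
        gcongr <;> omega

/-- Every polynomial is dominated by `c · smoothQPSim E n + c` (`2 ≤ E`). [folklore] -/
theorem exists_poly_le_smoothQPSim {E : ℕ} (hE : 2 ≤ E) (p : Polynomial ℕ) :
    ∃ c : ℕ, ∀ n : ℕ, p.eval n ≤ c * smoothQPSim E n + c := by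
  obtain ⟨c₁, d, h₁⟩ := exists_eval_le_mul_pow_add p
  refine ⟨c₁ * 2 ^ ((d + 1) * d) + c₁, fun n => ?_⟩
  calc p.eval n ≤ c₁ * n ^ d + c₁ := h₁ n
    _ ≤ c₁ * (2 ^ ((d + 1) * d) * smoothQPSim E n) + c₁ := by
        gcongr; exact pow_le_mul_smoothQPSim hE d n
    _ = (c₁ * 2 ^ ((d + 1) * d)) * smoothQPSim E n + c₁ := by ring
    _ ≤ (c₁ * 2 ^ ((d + 1) * d) + c₁) * smoothQPSim E n + (c₁ * 2 ^ ((d + 1) * d) + c₁) := by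
        gcongr <;> omega

/-! ### Growth of `log₂ g` and the upper sandwich by the level `n ^ (log₂ n) ^ (E + 2)` -/

/-- **Growth of `log₂ (smoothQP E n)`**: for `P ≤ E` and every constant `c`, eventually
`c · (log₂ n)^P ≤ log₂ (smoothQP E n)` (namely once `log₂ n ≥ c`). [folklore] -/
theorem eventually_mul_log_pow_le_log_smoothQP (E c P : ℕ) (hP : P ≤ E) :
    ∀ᶠ n in atTop, c * Nat.log 2 n ^ P ≤ Nat.log 2 (smoothQP E n) := by
  refine (eventually_ge_atTop (2 ^ c)).mono fun n hn => ?_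
  rw [log_smoothQP]
  have hj : c ≤ Nat.log 2 n := le_log_of_two_pow_le hn
  rcases Nat.eq_zero_or_pos c with hc | hc
  · rw [hc, zero_mul]; exact Nat.zero_le _
  · have hjpos : 0 < Nat.log 2 n := lt_of_lt_of_le hc hj
    calc c * Nat.log 2 n ^ P ≤ Nat.log 2 n * Nat.log 2 n ^ P := Nat.mul_le_mul_right _ hj
      _ = Nat.log 2 n ^ (P + 1) := by rw [pow_succ, mul_comm]
      _ ≤ Nat.log 2 n ^ (E + 1) := Nat.pow_le_pow_right hjpos (by omega)
      _ ≤ qpExp E n := pow_log_le_qpExp E n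

/-- The exponent inequality behind the upper sandwich: for `j ≥ 2^{E+1} + 2b + 2`,
`j + 1 + (j+1)^{E+1} + (j+2) b ≤ j^{E+3}`. [folklore] -/
theorem qpExp_upper_exponent_le {E b j : ℕ} (hj : 2 ^ (E + 1) + 2 * b + 2 ≤ j) :
    j + 1 + (j + 1) ^ (E + 1) + (j + 2) * b ≤ j ^ (E + 3) := by
  have h2E : 2 ≤ 2 ^ (E + 1) := by
    calc 2 = 2 ^ 1 := rfl
      _ ≤ 2 ^ (E + 1) := Nat.pow_le_pow_right two_pos (by omega)
  have hj1 : 1 ≤ j := by omega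
  have hj2 : 2 ≤ j := by omega
  have hpow1 : j ≤ j ^ (E + 1) := by
    calc j = j ^ 1 := (pow_one j).symm
      _ ≤ j ^ (E + 1) := Nat.pow_le_pow_right hj1 (by omega)
  -- `(j+1)^{E+1} ≤ (2j)^{E+1} = 2^{E+1} j^{E+1}`
  have h1 : (j + 1) ^ (E + 1) ≤ 2 ^ (E + 1) * j ^ (E + 1) := by
    calc (j + 1) ^ (E + 1) ≤ (2 * j) ^ (E + 1) := Nat.pow_le_pow_left (by omega) _
      _ = 2 ^ (E + 1) * j ^ (E + 1) := by rw [mul_pow]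
  -- `j + 1 + (j+2) b ≤ (2b + 2) j ≤ (2b+2) j^{E+1}`
  have h2 : j + 1 + (j + 2) * b ≤ (2 * b + 2) * j ^ (E + 1) := by
    calc j + 1 + (j + 2) * b ≤ (2 * b + 2) * j := by nlinarith
      _ ≤ (2 * b + 2) * j ^ (E + 1) := Nat.mul_le_mul_left _ hpow1
  calc j + 1 + (j + 1) ^ (E + 1) + (j + 2) * b
      ≤ (2 ^ (E + 1) + 2 * b + 2) * j ^ (E + 1) := by nlinarith [h1, h2]
    _ ≤ j * j ^ (E + 1) := Nat.mul_le_mul_right _ (by omega)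
    _ ≤ (j * j) * j ^ (E + 1) := Nat.mul_le_mul_right _ (Nat.le_mul_of_pos_left j (by omega))
    _ = j ^ (E + 3) := by ring

/-- For `log₂ n ≥ 2^{E+1} + 2b + 2`: `smoothQP E n · (n + 2)ᵇ ≤ n ^ (log₂ n) ^ (E + 2)`.
[folklore] -/
theorem smoothQP_mul_pow_le_of_le_log {E b n : ℕ} (hn : 2 ^ (E + 1) + 2 * b + 2 ≤ Nat.log 2 n) :
    smoothQP E n * (n + 2) ^ b ≤ n ^ Nat.log 2 n ^ (E + 2) := by
  set j := Nat.log 2 n with hj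
  have hjpos : 1 ≤ j := by have := Nat.one_le_two_pow (n := E + 1); omega
  have hn0 : n ≠ 0 := by
    intro h; rw [h, Nat.log_zero_right] at hj; omega
  have hnj : 2 ^ j ≤ n := by rw [hj]; exact Nat.pow_log_le_self 2 hn0
  have hlt : n < 2 ^ (j + 1) := Nat.lt_pow_succ_log_self one_lt_two n
  -- `n + 2 ≤ 2^{j+2}`
  have hn2 : n + 2 ≤ 2 ^ (j + 2) := by
    have : 2 ≤ 2 ^ (j + 1) := by
      calc 2 = 2 ^ 1 := rfl
        _ ≤ 2 ^ (j + 1) := Nat.pow_le_pow_right two_pos (by omega)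
    rw [pow_succ 2 (j + 1)]
    omega
  have hexp := qpExp_upper_exponent_le (E := E) (b := b) (j := j) hn
  calc smoothQP E n * (n + 2) ^ b
      ≤ 2 ^ (j + 1 + (j + 1) ^ (E + 1)) * (2 ^ (j + 2)) ^ b := by
        refine Nat.mul_le_mul (Nat.pow_le_pow_right two_pos ?_) (Nat.pow_le_pow_left hn2 b)
        rw [hj]; exact qpExp_le E n
    _ = 2 ^ (j + 1 + (j + 1) ^ (E + 1) + (j + 2) * b) := by rw [← pow_mul, ← pow_add]
    _ ≤ 2 ^ j ^ (E + 3) := Nat.pow_le_pow_right two_pos hexp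
    _ = (2 ^ j) ^ j ^ (E + 2) := by rw [← pow_mul]; ring_nf
    _ ≤ n ^ j ^ (E + 2) := Nat.pow_le_pow_left hnj _

/-- **Upper sandwich**: for every `b` there is a constant `a` with
`smoothQP E n · (n + 2)ᵇ ≤ a · n ^ (log₂ n) ^ (E + 2) + a` for all `n` (the finitely many `n`
below `2^{2^{E+1} + 2b + 2}` are absorbed by `a`). [folklore] -/
theorem exists_smoothQP_mul_pow_le (E b : ℕ) :
    ∃ a : ℕ, ∀ n : ℕ, smoothQP E n * (n + 2) ^ b ≤ a * n ^ Nat.log 2 n ^ (E + 2) + a := by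
  set j₀ := 2 ^ (E + 1) + 2 * b + 2
  refine ⟨∑ i ∈ Finset.range (2 ^ j₀), smoothQP E i * (i + 2) ^ b + 1, fun n => ?_⟩
  set a := ∑ i ∈ Finset.range (2 ^ j₀), smoothQP E i * (i + 2) ^ b + 1 with ha
  rcases lt_or_ge n (2 ^ j₀) with hn | hn
  · have h1 : smoothQP E n * (n + 2) ^ b ≤ ∑ i ∈ Finset.range (2 ^ j₀), smoothQP E i * (i + 2) ^ b :=
      Finset.single_le_sum (f := fun i => smoothQP E i * (i + 2) ^ b) (fun _ _ => Nat.zero_le _)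
        (Finset.mem_range.2 hn)
    calc smoothQP E n * (n + 2) ^ b ≤ a := by omega
      _ ≤ a * n ^ Nat.log 2 n ^ (E + 2) + a := Nat.le_add_left _ _
  · have hj : j₀ ≤ Nat.log 2 n := le_log_of_two_pow_le hn
    calc smoothQP E n * (n + 2) ^ b ≤ n ^ Nat.log 2 n ^ (E + 2) := smoothQP_mul_pow_le_of_le_log hj
      _ ≤ a * n ^ Nat.log 2 n ^ (E + 2) := Nat.le_mul_of_pos_left _ (by omega)
      _ ≤ a * n ^ Nat.log 2 n ^ (E + 2) + a := Nat.le_add_right _ _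

/-! ### The savings inequality `g · (log₂ g)ᵇ ≤ f · 2^{⌊(log₂ g)^{1/r}⌋}` -/

/-- `j³ ≤ ⌊(qpExp E n)^{1/r}⌋` when `1 ≤ r` and `3r ≤ E + 1` (`(j³)ʳ = j^{3r} ≤ j^{E+1} ≤ qpExp`).
[folklore] -/
theorem pow_log_three_le_nthRoot_qpExp {E r : ℕ} (hr : 1 ≤ r) (hE : 3 * r ≤ E + 1) (n : ℕ) :
    Nat.log 2 n ^ 3 ≤ Nat.nthRoot r (qpExp E n) := by
  rw [Nat.le_nthRoot_iff (by omega), ← pow_mul]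
  rcases Nat.eq_zero_or_pos (Nat.log 2 n) with h | h
  · rw [h, zero_pow (by omega)]; exact Nat.zero_le _
  · exact (Nat.pow_le_pow_right h hE).trans (pow_log_le_qpExp E n)

/-- `qpExp E n < 2^{(E+2)(j+1)}` (crude: `qpExp ≤ j + 1 + (j+1)^{E+1}`, `x < 2ˣ`). [folklore] -/
theorem qpExp_lt_two_pow (E n : ℕ) : qpExp E n < 2 ^ ((E + 2) * (Nat.log 2 n + 1)) := by
  set j := Nat.log 2 n
  have h1 : qpExp E n ≤ j + 1 + (j + 1) ^ (E + 1) := qpExp_le E n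
  have h2 : (j + 1) ^ (E + 1) < 2 ^ ((E + 1) * (j + 1)) := by
    calc (j + 1) ^ (E + 1) < (2 ^ (j + 1)) ^ (E + 1) :=
          Nat.pow_lt_pow_left Nat.lt_two_pow_self (by omega)
      _ = 2 ^ ((E + 1) * (j + 1)) := by rw [← pow_mul, mul_comm]
  have h3 : j + 1 < 2 ^ (j + 1) := Nat.lt_two_pow_self
  have h4 : 2 ^ (j + 1) + 2 ^ ((E + 1) * (j + 1)) ≤ 2 ^ ((E + 2) * (j + 1)) := by
    have e1 : 2 ^ (j + 1) ≤ 2 ^ ((E + 1) * (j + 1)) :=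
      Nat.pow_le_pow_right two_pos (Nat.le_mul_of_pos_left _ (by omega))
    calc 2 ^ (j + 1) + 2 ^ ((E + 1) * (j + 1)) ≤ 2 * 2 ^ ((E + 1) * (j + 1)) := by omega
      _ = 2 ^ ((E + 1) * (j + 1) + 1) := by rw [pow_succ, mul_comm]
      _ ≤ 2 ^ ((E + 2) * (j + 1)) := Nat.pow_le_pow_right two_pos (by nlinarith)
  omega

/-- The exponent inequality behind the savings: for `j ≥ 2b(E+2) + 2`,
`b (E+2)(j+1) + j² ≤ j³`. [folklore] -/
theorem savings_exponent_le {E b j : ℕ} (hj : 2 * b * (E + 2) + 2 ≤ j) :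
    b * ((E + 2) * (j + 1)) + j ^ 2 ≤ j ^ 3 := by
  have hj2 : 2 ≤ j := by omega
  -- `b (E+2)(j+1) ≤ 2 b (E+2) j ≤ (j - 1) j`, and `(j - 1) j + j² ≤ j³`
  have h1 : b * ((E + 2) * (j + 1)) ≤ 2 * b * (E + 2) * j := by
    calc b * ((E + 2) * (j + 1)) = b * (E + 2) * (j + 1) := by ring
      _ ≤ b * (E + 2) * (2 * j) := Nat.mul_le_mul_left _ (by omega)
      _ = 2 * b * (E + 2) * j := by ring
  have h2 : 2 * b * (E + 2) ≤ j - 1 := by omega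
  have h3 : 2 * b * (E + 2) * j ≤ (j - 1) * j := Nat.mul_le_mul_right _ h2
  have h4 : (j - 1) * j + j ^ 2 ≤ j ^ 3 := by
    have : (j - 1) * j + j ^ 2 = (j - 1 + j) * j := by ring
    rw [this]
    have h5 : j - 1 + j ≤ j * j := by
      have : j - 1 + j ≤ 2 * j := by omega
      nlinarith
    calc (j - 1 + j) * j ≤ (j * j) * j := Nat.mul_le_mul_right _ h5
      _ = j ^ 3 := by ring
  omega

/-- **The savings inequality**, for `1 ≤ r` and `3r ≤ E + 1`: eventually
`smoothQP E n · (log₂ (smoothQP E n))ᵇ ≤ smoothQPSim E n · 2 ^ ⌊(log₂ (smoothQP E n))^{1/r}⌋`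
(namely once `log₂ n ≥ 2b(E+2) + 2`: `(log₂ g)ᵇ = qpExpᵇ < 2^{b(E+2)(j+1)} ≤ 2^{j³ - j²}` and
`⌊qpExp^{1/r}⌋ ≥ j³`). This is the shape of the running-time condition of the simulation in
`MurrayWilliams2018Transfer.lean`. [folklore] -/
theorem eventually_smoothQP_mul_log_pow_le {E r : ℕ} (hr : 1 ≤ r) (hE : 3 * r ≤ E + 1) (b : ℕ) :
    ∀ᶠ n in atTop, smoothQP E n * Nat.log 2 (smoothQP E n) ^ b ≤
      smoothQPSim E n * 2 ^ Nat.nthRoot r (Nat.log 2 (smoothQP E n)) := by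
  refine (eventually_ge_atTop (2 ^ (2 * b * (E + 2) + 2))).mono fun n hn => ?_
  have hE1 : 1 ≤ E := by omega
  set j := Nat.log 2 n with hj
  have hjb : 2 * b * (E + 2) + 2 ≤ j := le_log_of_two_pow_le hn
  rw [log_smoothQP]
  -- `(qpExp)^b ≤ 2^{b (E+2)(j+1)}`
  have hq : qpExp E n ^ b ≤ 2 ^ (b * ((E + 2) * (j + 1))) := by
    calc qpExp E n ^ b ≤ (2 ^ ((E + 2) * (j + 1))) ^ b :=
          Nat.pow_le_pow_left (qpExp_lt_two_pow E n).le b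
      _ = 2 ^ (b * ((E + 2) * (j + 1))) := by rw [← pow_mul, mul_comm]
  have hroot : j ^ 3 ≤ Nat.nthRoot r (qpExp E n) := pow_log_three_le_nthRoot_qpExp hr hE n
  have hsq : j ^ 2 ≤ qpExp E n := log_sq_le_qpExp hE1 n
  have hexp : qpExp E n + b * ((E + 2) * (j + 1)) ≤ (qpExp E n - j ^ 2) + j ^ 3 := by
    have := savings_exponent_le (E := E) (b := b) hjb
    omega
  calc smoothQP E n * qpExp E n ^ b
      ≤ 2 ^ qpExp E n * 2 ^ (b * ((E + 2) * (j + 1))) := Nat.mul_le_mul_left _ hq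
    _ = 2 ^ (qpExp E n + b * ((E + 2) * (j + 1))) := by rw [← pow_add]
    _ ≤ 2 ^ ((qpExp E n - j ^ 2) + j ^ 3) := Nat.pow_le_pow_right two_pos hexp
    _ = smoothQPSim E n * 2 ^ j ^ 3 := by rw [pow_add, smoothQPSim]
    _ ≤ smoothQPSim E n * 2 ^ Nat.nthRoot r (qpExp E n) :=
        Nat.mul_le_mul_left _ (Nat.pow_le_pow_right two_pos hroot)

/-! ### Smoothness: `qpExp E (n + 1) ≤ qpExp E n + 2` eventually, and `f(n + 1) = o(g(n))` -/

/-- Eventually (in `j`) the increment `(j+1)^{E+1}` is at most `2ʲ`. [folklore] -/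
theorem exists_pow_succ_le_two_pow (E : ℕ) : ∃ j₀ : ℕ, ∀ j, j₀ ≤ j → (j + 1) ^ (E + 1) ≤ 2 ^ j := by
  obtain ⟨C, hC⟩ := TimeConstructible.exists_pow_le_mul_two_pow (E + 2)
  refine ⟨2 * C, fun j hj => ?_⟩
  have h := hC (j + 1)
  -- `(j+1)^{E+2} = (j+1)^{E+1} (j+1) ≤ C 2^{j+1} = 2C 2^j ≤ (j+1) 2^j`
  have h1 : (j + 1) ^ (E + 1) * (j + 1) ≤ (j + 1) * 2 ^ j := by
    calc (j + 1) ^ (E + 1) * (j + 1) = (j + 1) ^ (E + 2) := by rw [← pow_succ]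
      _ ≤ C * 2 ^ (j + 1) := h
      _ = 2 * C * 2 ^ j := by rw [pow_succ]; ring
      _ ≤ (j + 1) * 2 ^ j := Nat.mul_le_mul_right _ (by omega)
  rw [mul_comm (j + 1) (2 ^ j)] at h1
  exact Nat.le_of_mul_le_mul_right h1 (Nat.succ_pos j)

/-- The increment of the interpolation: `Δⱼ = (j+1)^{E+1} - j^{E+1} ≤ 2ʲ` for large `j`.
[folklore] -/
theorem exists_increment_le_two_pow (E : ℕ) :
    ∃ j₀ : ℕ, ∀ j, j₀ ≤ j → (j + 1) ^ (E + 1) - j ^ (E + 1) ≤ 2 ^ j := by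
  obtain ⟨j₀, h⟩ := exists_pow_succ_le_two_pow E
  exact ⟨j₀, fun j hj => (Nat.sub_le _ _).trans (h j hj)⟩

/-- `qpExp` within a dyadic block: if `log₂ (n + 1) = log₂ n = j` and `Δⱼ ≤ 2ʲ`, then
`qpExp E (n + 1) ≤ qpExp E n + 2`. [folklore] -/
theorem qpExp_succ_le_of_log_eq {E n : ℕ} (hlog : Nat.log 2 (n + 1) = Nat.log 2 n)
    (hΔ : (Nat.log 2 n + 1) ^ (E + 1) - Nat.log 2 n ^ (E + 1) ≤ 2 ^ Nat.log 2 n) :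
    qpExp E (n + 1) ≤ qpExp E n + 2 := by
  unfold qpExp
  rw [hlog]
  set j := Nat.log 2 n
  set D := (j + 1) ^ (E + 1) - j ^ (E + 1)
  have hpos : 0 < 2 ^ j := Nat.two_pow_pos j
  have hs : n + 1 - 2 ^ j ≤ (n - 2 ^ j) + 1 := by omega
  have h1 : (n + 1 - 2 ^ j) * D / 2 ^ j ≤ ((n - 2 ^ j) * D + D) / 2 ^ j := by
    refine Nat.div_le_div_right ?_
    calc (n + 1 - 2 ^ j) * D ≤ ((n - 2 ^ j) + 1) * D := Nat.mul_le_mul_right _ hs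
      _ = (n - 2 ^ j) * D + D := by ring
  have h2 : ((n - 2 ^ j) * D + D) / 2 ^ j ≤ (n - 2 ^ j) * D / 2 ^ j + D / 2 ^ j + 1 := by
    rw [Nat.add_div hpos]
    split_ifs <;> omega
  have h3 : D / 2 ^ j ≤ 1 := by
    rw [Nat.div_le_iff_le_mul_add_pred hpos]
    omega
  omega

/-- `qpExp` across a dyadic boundary: if `n + 1 = 2^{j+1}` (`j = log₂ n`) and `Δⱼ ≤ 2ʲ`, then
`qpExp E (n + 1) ≤ qpExp E n + 2`. [folklore] -/
theorem qpExp_succ_le_of_eq_two_pow {E n : ℕ} (hn : n + 1 = 2 ^ (Nat.log 2 n + 1))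
    (hΔ : (Nat.log 2 n + 1) ^ (E + 1) - Nat.log 2 n ^ (E + 1) ≤ 2 ^ Nat.log 2 n) :
    qpExp E (n + 1) ≤ qpExp E n + 2 := by
  set j := Nat.log 2 n with hj
  have hlog' : Nat.log 2 (n + 1) = j + 1 := by rw [hn, Nat.log_pow one_lt_two]
  have hval' : qpExp E (n + 1) = j + 2 + (j + 1) ^ (E + 1) := by
    unfold qpExp
    rw [hlog', hn, Nat.sub_self, zero_mul, Nat.zero_div, add_zero]
  -- lower bound for `qpExp E n`: the interpolation term is `≥ Δ - 1`
  set D := (j + 1) ^ (E + 1) - j ^ (E + 1) with hD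
  have hpos : 0 < 2 ^ j := Nat.two_pow_pos j
  have hs : n - 2 ^ j = 2 ^ j - 1 := by rw [pow_succ] at hn; omega
  have hq : D - 1 ≤ (n - 2 ^ j) * D / 2 ^ j := by
    rw [hs, Nat.le_div_iff_mul_le hpos]
    -- `(D - 1) 2^j ≤ (2^j - 1) D` iff `D ≤ 2^j` (when `D ≥ 1`)
    rcases Nat.eq_zero_or_pos D with h0 | hDpos
    · simp [h0]
    · have h1 : (D - 1) * 2 ^ j + 2 ^ j = D * 2 ^ j := by
        rw [← Nat.succ_mul]; congr 1; omega
      have h2 : (2 ^ j - 1) * D + D = 2 ^ j * D := by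
        rw [← Nat.succ_mul]; congr 1; omega
      nlinarith [hΔ, h1, h2]
  have hmono : j ^ (E + 1) ≤ (j + 1) ^ (E + 1) := Nat.pow_le_pow_left (Nat.le_succ _) _
  have hval : j + 1 + j ^ (E + 1) + (D - 1) ≤ qpExp E n := by
    have hq' : j + 1 + j ^ (E + 1) + (D - 1) ≤ j + 1 + j ^ (E + 1) + (n - 2 ^ j) * D / 2 ^ j :=
      Nat.add_le_add_left hq _
    have he : qpExp E n = j + 1 + j ^ (E + 1) + (n - 2 ^ j) * D / 2 ^ j := by
      simp only [qpExp, ← hj, ← hD]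
    rw [he]; exact hq'
  rw [hval']
  omega

/-- **Smoothness of the exponent**: eventually `qpExp E (n + 1) ≤ qpExp E n + 2`. [folklore] -/
theorem eventually_qpExp_succ_le (E : ℕ) : ∀ᶠ n in atTop, qpExp E (n + 1) ≤ qpExp E n + 2 := by
  obtain ⟨j₀, hj₀⟩ := exists_increment_le_two_pow E
  refine (eventually_ge_atTop (2 ^ j₀)).mono fun n hn => ?_
  have hj : j₀ ≤ Nat.log 2 n := le_log_of_two_pow_le hn
  have hΔ := hj₀ _ hj
  -- `log₂ (n+1)` is `j` or `j + 1`
  have hle : Nat.log 2 n ≤ Nat.log 2 (n + 1) := Nat.log_mono_right (Nat.le_succ n)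
  have hlt : n + 1 ≤ 2 ^ (Nat.log 2 n + 1) := Nat.lt_pow_succ_log_self one_lt_two n
  rcases hlt.lt_or_eq with h | h
  · -- same block
    have hlog : Nat.log 2 (n + 1) = Nat.log 2 n := by
      refine le_antisymm ?_ hle
      exact Nat.lt_succ_iff.mp (Nat.log_lt_of_lt_pow' (by omega) h)
    exact qpExp_succ_le_of_log_eq hlog hΔ
  · exact qpExp_succ_le_of_eq_two_pow h hΔ

/-- Eventually `smoothQPSim E (n + 1) · (n + 1) ≤ 8 · smoothQP E n` (`1 ≤ E`): indeed
`f(n+1) ≤ 2^{qpExp E n + 2 - j²}`, `2^{j²} ≥ 2ʲ` and `2 · 2ʲ ≥ n + 1`. [folklore] -/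
theorem eventually_smoothQPSim_succ_mul_le {E : ℕ} (hE : 1 ≤ E) :
    ∀ᶠ n in atTop, smoothQPSim E (n + 1) * (n + 1) ≤ 8 * smoothQP E n := by
  refine (eventually_qpExp_succ_le E).mono fun n hn => ?_
  set j := Nat.log 2 n with hj
  have hle : j ≤ Nat.log 2 (n + 1) := Nat.log_mono_right (Nat.le_succ n)
  have hsq : j ^ 2 ≤ qpExp E n := log_sq_le_qpExp hE n
  -- exponent bound
  have hexp : qpExp E (n + 1) - Nat.log 2 (n + 1) ^ 2 + j ^ 2 ≤ qpExp E n + 2 := by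
    have hjj : j ^ 2 ≤ Nat.log 2 (n + 1) ^ 2 := Nat.pow_le_pow_left hle 2
    have h1 : qpExp E (n + 1) - Nat.log 2 (n + 1) ^ 2 ≤ qpExp E (n + 1) - j ^ 2 :=
      Nat.sub_le_sub_left hjj _
    have h2 : qpExp E (n + 1) - j ^ 2 + j ^ 2 ≤ qpExp E n + 2 := by
      rcases le_or_gt (j ^ 2) (qpExp E (n + 1)) with h | h
      · rw [Nat.sub_add_cancel h]; exact hn
      · rw [Nat.sub_eq_zero_of_le h.le, zero_add]; exact hsq.trans (Nat.le_add_right _ _)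
    exact (Nat.add_le_add_right h1 _).trans h2
  have hjsq : j ≤ j ^ 2 := by nlinarith
  have hn1 : n + 1 ≤ 2 * 2 ^ j := by
    have := Nat.lt_pow_succ_log_self one_lt_two n; rw [← hj, pow_succ] at this; omega
  calc smoothQPSim E (n + 1) * (n + 1)
      ≤ 2 ^ (qpExp E (n + 1) - Nat.log 2 (n + 1) ^ 2) * (2 * 2 ^ j) := Nat.mul_le_mul_left _ hn1
    _ ≤ 2 ^ (qpExp E (n + 1) - Nat.log 2 (n + 1) ^ 2) * (2 * 2 ^ j ^ 2) :=
        Nat.mul_le_mul_left _ (Nat.mul_le_mul_left _ (Nat.pow_le_pow_right two_pos hjsq))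
    _ = 2 * 2 ^ (qpExp E (n + 1) - Nat.log 2 (n + 1) ^ 2 + j ^ 2) := by rw [pow_add]; ring
    _ ≤ 2 * 2 ^ (qpExp E n + 2) := Nat.mul_le_mul_left _ (Nat.pow_le_pow_right two_pos hexp)
    _ = 8 * smoothQP E n := by rw [pow_add, smoothQP]; ring

/-- **The hierarchy side condition**: `smoothQPSim E (n + 1) = o(smoothQP E n)` (`1 ≤ E`), the
hypothesis `f(n + 1) = o(g(n))` of the nondeterministic time hierarchy theorem (Arora–Barak 2009,
Thm. 3.2) for `f = smoothQPSim E`, `g = smoothQP E`. [cite: AroraBarakCC2009, Thm. 3.2] -/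
theorem isLittleO_smoothQPSim_succ {E : ℕ} (hE : 1 ≤ E) :
    (fun n => (smoothQPSim E (n + 1) : ℝ)) =o[atTop] fun n => (smoothQP E n : ℝ) := by
  refine isLittleO_iff.2 fun c hc => ?_
  have hev := eventually_smoothQPSim_succ_mul_le hE
  obtain ⟨N, hN⟩ := exists_nat_gt (8 / c)
  filter_upwards [hev, eventually_ge_atTop N] with n hn hnN
  rw [Real.norm_natCast, Real.norm_natCast]
  have hn1 : (0 : ℝ) < (n : ℝ) + 1 := by positivity
  have hcast : (smoothQPSim E (n + 1) : ℝ) * ((n : ℝ) + 1) ≤ 8 * (smoothQP E n : ℝ) := by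
    exact_mod_cast hn
  have h8 : (8 : ℝ) ≤ c * ((n : ℝ) + 1) := by
    have h1 : 8 / c < (n : ℝ) + 1 := lt_of_lt_of_le hN (by exact_mod_cast Nat.le_succ_of_le hnN)
    rw [div_lt_iff₀ hc] at h1
    linarith
  -- `f(n+1) (n+1) ≤ 8 g ≤ c (n+1) g`
  have hg0 : (0 : ℝ) ≤ (smoothQP E n : ℝ) := Nat.cast_nonneg _
  have key : (smoothQPSim E (n + 1) : ℝ) * ((n : ℝ) + 1) ≤ c * (smoothQP E n : ℝ) * ((n : ℝ) + 1) := by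
    calc (smoothQPSim E (n + 1) : ℝ) * ((n : ℝ) + 1) ≤ 8 * (smoothQP E n : ℝ) := hcast
      _ ≤ c * ((n : ℝ) + 1) * (smoothQP E n : ℝ) := mul_le_mul_of_nonneg_right h8 hg0
      _ = c * (smoothQP E n : ℝ) * ((n : ℝ) + 1) := by ring
  exact le_of_mul_le_mul_right key hn1

/-! ### The machines: `1ⁿ ↦ bin (smoothQP E n)` and `1ⁿ ↦ bin (smoothQPSim E n)` in `FP` -/

namespace Brick

open HashBricks

/-- Iterated product brick: `w ↦ bin (⟦w⟧^i)`. [folklore] -/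
def natPowFn : ℕ → (List Bool → List Bool)
  | 0 => fun _ => encodeNat 1
  | i + 1 => prodFn ∘ fanoutFn id (natPowFn i)

/-- `natPowFn i ∈ FP`. [folklore] -/
theorem natPowFn_mem_FP : ∀ i : ℕ, natPowFn i ∈ FP
  | 0 => const_mem_FP _
  | i + 1 => comp_mem_FP prodFn_mem_FP (fanoutFn_mem_FP OracleCompose.id_mem_FP (natPowFn_mem_FP i))

/-- `natPowFn i w = bin (⟦w⟧^i)`. [folklore] -/
@[simp] theorem natPowFn_apply : ∀ (i : ℕ) (w : List Bool), natPowFn i w = encodeNat (bitsToNat w ^ i)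
  | 0, w => by simp [natPowFn]
  | i + 1, w => by
    simp only [natPowFn, Function.comp_apply, fanoutFn_apply, id, natPowFn_apply i w,
      prodFn_boolPair, bitsToNat_encodeNat, pow_succ']

/-- `1ⁿ ↦ bin n` (population count of the unary input). [folklore] -/
def qpN : List Bool → List Bool := popCountFn

/-- `1ⁿ ↦ bin (log₂ n)`: the length of `bin n` is `log₂ n + 1` (`n ≠ 0`), counted in binary and
decremented; for `n = 0` both sides are `0`. [folklore] -/
def qpJ : List Bool → List Bool := subFn ∘ fanoutFn (popCountFn ∘ onesFn ∘ qpN) (fun _ => encodeNat 1)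

/-- `1ⁿ ↦ bin (log₂ n + 1)`. [folklore] -/
def qpJs : List Bool → List Bool := addFn ∘ fanoutFn qpJ (fun _ => encodeNat 1)

/-- `1ⁿ ↦ bin (2 ^ log₂ n)` for `n ≠ 0` (a modular power below the modulus `n + 1`). [folklore] -/
def qpP2J : List Bool → List Bool :=
  modExpFn ∘ fanoutFn (fun _ => encodeNat 2) (fanoutFn qpJ (addFn ∘ fanoutFn qpN (fun _ => encodeNat 1)))

/-- `1ⁿ ↦ bin (n - 2 ^ log₂ n)`. [folklore] -/
def qpS : List Bool → List Bool := subFn ∘ fanoutFn qpN qpP2J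

/-- `1ⁿ ↦ bin ((log₂ n + 1)^{E+1} - (log₂ n)^{E+1})`. [folklore] -/
def qpD (E : ℕ) : List Bool → List Bool :=
  subFn ∘ fanoutFn (natPowFn (E + 1) ∘ qpJs) (natPowFn (E + 1) ∘ qpJ)

/-- `1ⁿ ↦ bin ⌊(n - 2ʲ) Δ / 2ʲ⌋`. [folklore] -/
def qpQ (E : ℕ) : List Bool → List Bool := divFn ∘ fanoutFn (prodFn ∘ fanoutFn qpS (qpD E)) qpP2J

/-- `1ⁿ ↦ bin (qpExp E n)`. [folklore] -/
def qpE (E : ℕ) : List Bool → List Bool :=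
  addFn ∘ fanoutFn (addFn ∘ fanoutFn qpJs (natPowFn (E + 1) ∘ qpJ)) (qpQ E)

/-- `1ⁿ ↦ bin (2 · (2^{n^{E+1}})² + 1)`: a modulus exceeding `2^{qpExp E n}`. [folklore] -/
def qpM (E : ℕ) : List Bool → List Bool :=
  addFn ∘ fanoutFn (prodFn ∘ fanoutFn (fun _ => encodeNat 2)
    (prodFn ∘ fanoutFn (TimeConstructible.powFn (E + 1)) (TimeConstructible.powFn (E + 1))))
    (fun _ => encodeNat 1)

/-- `1ⁿ ↦ bin (smoothQP E n)` (`2^{qpExp}` as a modular power below `qpM`). [folklore] -/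
def smoothQPFn (E : ℕ) : List Bool → List Bool :=
  modExpFn ∘ fanoutFn (fun _ => encodeNat 2) (fanoutFn (qpE E) (qpM E))

/-- `1ⁿ ↦ bin (smoothQPSim E n)`. [folklore] -/
def smoothQPSimFn (E : ℕ) : List Bool → List Bool :=
  modExpFn ∘ fanoutFn (fun _ => encodeNat 2)
    (fanoutFn (subFn ∘ fanoutFn (qpE E) (prodFn ∘ fanoutFn qpJ qpJ)) (qpM E))

/-! #### Membership in `FP` -/

/-- `qpN ∈ FP`. [folklore] -/
theorem qpN_mem_FP : qpN ∈ FP := popCountFn_mem_FP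

/-- `qpJ ∈ FP`. [folklore] -/
theorem qpJ_mem_FP : qpJ ∈ FP :=
  comp_mem_FP subFn_mem_FP (fanoutFn_mem_FP
    (comp_mem_FP popCountFn_mem_FP (comp_mem_FP onesFn_mem_FP qpN_mem_FP)) (const_mem_FP _))

/-- `qpJs ∈ FP`. [folklore] -/
theorem qpJs_mem_FP : qpJs ∈ FP :=
  comp_mem_FP addFn_mem_FP (fanoutFn_mem_FP qpJ_mem_FP (const_mem_FP _))

/-- `qpP2J ∈ FP`. [folklore] -/
theorem qpP2J_mem_FP : qpP2J ∈ FP :=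
  comp_mem_FP modExpFn_mem_FP (fanoutFn_mem_FP (const_mem_FP _) (fanoutFn_mem_FP qpJ_mem_FP
    (comp_mem_FP addFn_mem_FP (fanoutFn_mem_FP qpN_mem_FP (const_mem_FP _)))))

/-- `qpS ∈ FP`. [folklore] -/
theorem qpS_mem_FP : qpS ∈ FP :=
  comp_mem_FP subFn_mem_FP (fanoutFn_mem_FP qpN_mem_FP qpP2J_mem_FP)

/-- `qpD E ∈ FP`. [folklore] -/
theorem qpD_mem_FP (E : ℕ) : qpD E ∈ FP :=
  comp_mem_FP subFn_mem_FP (fanoutFn_mem_FP (comp_mem_FP (natPowFn_mem_FP _) qpJs_mem_FP)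
    (comp_mem_FP (natPowFn_mem_FP _) qpJ_mem_FP))

/-- `qpQ E ∈ FP`. [folklore] -/
theorem qpQ_mem_FP (E : ℕ) : qpQ E ∈ FP :=
  comp_mem_FP divFn_mem_FP (fanoutFn_mem_FP
    (comp_mem_FP prodFn_mem_FP (fanoutFn_mem_FP qpS_mem_FP (qpD_mem_FP E))) qpP2J_mem_FP)

/-- `qpE E ∈ FP`. [folklore] -/
theorem qpE_mem_FP (E : ℕ) : qpE E ∈ FP :=
  comp_mem_FP addFn_mem_FP (fanoutFn_mem_FP
    (comp_mem_FP addFn_mem_FP (fanoutFn_mem_FP qpJs_mem_FP (comp_mem_FP (natPowFn_mem_FP _) qpJ_mem_FP)))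
    (qpQ_mem_FP E))

/-- `qpM E ∈ FP`. [folklore] -/
theorem qpM_mem_FP (E : ℕ) : qpM E ∈ FP :=
  comp_mem_FP addFn_mem_FP (fanoutFn_mem_FP
    (comp_mem_FP prodFn_mem_FP (fanoutFn_mem_FP (const_mem_FP _)
      (comp_mem_FP prodFn_mem_FP (fanoutFn_mem_FP (TimeConstructible.powFn_mem_FP _)
        (TimeConstructible.powFn_mem_FP _)))))
    (const_mem_FP _))

/-- `smoothQPFn E ∈ FP`. [folklore] -/
theorem smoothQPFn_mem_FP (E : ℕ) : smoothQPFn E ∈ FP :=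
  comp_mem_FP modExpFn_mem_FP (fanoutFn_mem_FP (const_mem_FP _)
    (fanoutFn_mem_FP (qpE_mem_FP E) (qpM_mem_FP E)))

/-- `smoothQPSimFn E ∈ FP`. [folklore] -/
theorem smoothQPSimFn_mem_FP (E : ℕ) : smoothQPSimFn E ∈ FP :=
  comp_mem_FP modExpFn_mem_FP (fanoutFn_mem_FP (const_mem_FP _)
    (fanoutFn_mem_FP (comp_mem_FP subFn_mem_FP (fanoutFn_mem_FP (qpE_mem_FP E)
      (comp_mem_FP prodFn_mem_FP (fanoutFn_mem_FP qpJ_mem_FP qpJ_mem_FP)))) (qpM_mem_FP E)))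

/-! #### Values on unary inputs -/

/-- `qpN (1ⁿ) = bin n`. [folklore] -/
@[simp] theorem qpN_unary (n : ℕ) : qpN (unaryEncodeNat n) = encodeNat n := by
  rw [qpN, popCountFn_apply, OracleCompose.unaryEncodeNat_eq_replicate, List.count_replicate_self]

/-- `qpJ (1ⁿ) = bin (log₂ n)`. [folklore] -/
@[simp] theorem qpJ_unary (n : ℕ) : qpJ (unaryEncodeNat n) = encodeNat (Nat.log 2 n) := by
  have hlen : (onesFn (encodeNat n)).count true = (encodeNat n).length := by
    rw [onesFn, OracleCompose.unaryEncodeNat_eq_replicate, List.count_replicate_self]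
  simp only [qpJ, Function.comp_apply, fanoutFn_apply, qpN_unary, popCountFn_apply, hlen,
    subFn_boolPair, bitsToNat_encodeNat, TM2Pass.length_encodeNat_eq_size]
  rcases Nat.eq_zero_or_pos n with rfl | hn
  · simp
  · have hsize : n.size = Nat.log 2 n + 1 :=
      le_antisymm (Nat.size_le.2 (Nat.lt_pow_succ_log_self one_lt_two n))
        (Nat.lt_size.2 (Nat.pow_log_le_self 2 (by omega)))
    rw [hsize, Nat.add_sub_cancel]

/-- `qpJs (1ⁿ) = bin (log₂ n + 1)`. [folklore] -/
@[simp] theorem qpJs_unary (n : ℕ) : qpJs (unaryEncodeNat n) = encodeNat (Nat.log 2 n + 1) := by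
  simp [qpJs]

/-- `qpP2J (1ⁿ) = bin (2 ^ log₂ n)` for `n ≠ 0` (`2 ^ log₂ n ≤ n < n + 1`, the modulus).
[folklore] -/
theorem qpP2J_unary {n : ℕ} (hn : n ≠ 0) : qpP2J (unaryEncodeNat n) = encodeNat (2 ^ Nat.log 2 n) := by
  have hm : 2 ≤ bitsToNat (encodeNat (n + 1)) := by rw [bitsToNat_encodeNat]; omega
  simp only [qpP2J, Function.comp_apply, fanoutFn_apply, qpN_unary, qpJ_unary, addFn_boolPair,
    bitsToNat_encodeNat]
  rw [modExpFn_boolPair hm, bitsToNat_encodeNat, bitsToNat_encodeNat, bitsToNat_encodeNat,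
    Nat.mod_eq_of_lt (Nat.lt_succ_of_le (Nat.pow_log_le_self 2 hn))]

/-- `qpS (1ⁿ) = bin (n - 2 ^ log₂ n)`. [folklore] -/
@[simp] theorem qpS_unary (n : ℕ) : qpS (unaryEncodeNat n) = encodeNat (n - 2 ^ Nat.log 2 n) := by
  rcases Nat.eq_zero_or_pos n with rfl | hn
  · simp [qpS]
  · simp [qpS, qpP2J_unary (show n ≠ 0 by omega)]

/-- `qpD E (1ⁿ) = bin Δⱼ`. [folklore] -/
@[simp] theorem qpD_unary (E n : ℕ) :
    qpD E (unaryEncodeNat n) = encodeNat ((Nat.log 2 n + 1) ^ (E + 1) - Nat.log 2 n ^ (E + 1)) := by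
  simp [qpD]

/-- `qpQ E (1ⁿ) = bin ⌊(n - 2ʲ) Δⱼ / 2ʲ⌋`. [folklore] -/
@[simp] theorem qpQ_unary (E n : ℕ) :
    qpQ E (unaryEncodeNat n) = encodeNat ((n - 2 ^ Nat.log 2 n) *
      ((Nat.log 2 n + 1) ^ (E + 1) - Nat.log 2 n ^ (E + 1)) / 2 ^ Nat.log 2 n) := by
  rcases Nat.eq_zero_or_pos n with rfl | hn
  · simp [qpQ]
  · simp [qpQ, qpP2J_unary (show n ≠ 0 by omega)]

/-- `qpE E (1ⁿ) = bin (qpExp E n)`. [folklore] -/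
@[simp] theorem qpE_unary (E n : ℕ) : qpE E (unaryEncodeNat n) = encodeNat (qpExp E n) := by
  simp [qpE, qpExp]

/-- `qpM E (1ⁿ) = bin (2 · (2^{n^{E+1}})² + 1)`. [folklore] -/
@[simp] theorem qpM_unary (E n : ℕ) :
    qpM E (unaryEncodeNat n) = encodeNat (2 * (2 ^ n ^ (E + 1) * 2 ^ n ^ (E + 1)) + 1) := by
  simp [qpM, TimeConstructible.powFn_unary]

/-- The modulus exceeds the power: `2 ^ qpExp E n < 2 · (2^{n^{E+1}})² + 1`. [folklore] -/
theorem two_pow_qpExp_lt_modulus (E n : ℕ) :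
    2 ^ qpExp E n < 2 * (2 ^ n ^ (E + 1) * 2 ^ n ^ (E + 1)) + 1 := by
  have hle : qpExp E n ≤ 1 + 2 * n ^ (E + 1) := by
    rcases Nat.eq_zero_or_pos n with rfl | hn
    · simp [qpExp]
    · have h1 := qpExp_le E n
      have hj : Nat.log 2 n + 1 ≤ n := Nat.log_lt_self 2 (by omega)
      have h2 : (Nat.log 2 n + 1) ^ (E + 1) ≤ n ^ (E + 1) := Nat.pow_le_pow_left hj _
      have h3 : n ≤ n ^ (E + 1) := Nat.le_self_pow (by omega) n
      omega
  calc 2 ^ qpExp E n ≤ 2 ^ (1 + 2 * n ^ (E + 1)) := Nat.pow_le_pow_right two_pos hle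
    _ = 2 * (2 ^ n ^ (E + 1) * 2 ^ n ^ (E + 1)) := by ring
    _ < _ := Nat.lt_succ_self _

/-- `smoothQPFn E (1ⁿ) = bin (smoothQP E n)`. [folklore] -/
theorem smoothQPFn_unary (E n : ℕ) : smoothQPFn E (unaryEncodeNat n) = encodeNat (smoothQP E n) := by
  have hm : 2 ≤ bitsToNat (encodeNat (2 * (2 ^ n ^ (E + 1) * 2 ^ n ^ (E + 1)) + 1)) := by
    rw [bitsToNat_encodeNat]; have := Nat.one_le_two_pow (n := n ^ (E + 1)); nlinarith
  simp only [smoothQPFn, Function.comp_apply, fanoutFn_apply, qpE_unary, qpM_unary]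
  rw [modExpFn_boolPair hm, bitsToNat_encodeNat, bitsToNat_encodeNat, bitsToNat_encodeNat,
    Nat.mod_eq_of_lt (two_pow_qpExp_lt_modulus E n), smoothQP]

/-- `smoothQPSimFn E (1ⁿ) = bin (smoothQPSim E n)`. [folklore] -/
theorem smoothQPSimFn_unary (E n : ℕ) :
    smoothQPSimFn E (unaryEncodeNat n) = encodeNat (smoothQPSim E n) := by
  have hm : 2 ≤ bitsToNat (encodeNat (2 * (2 ^ n ^ (E + 1) * 2 ^ n ^ (E + 1)) + 1)) := by
    rw [bitsToNat_encodeNat]; have := Nat.one_le_two_pow (n := n ^ (E + 1)); nlinarith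
  have hlt : 2 ^ (qpExp E n - Nat.log 2 n ^ 2) < 2 * (2 ^ n ^ (E + 1) * 2 ^ n ^ (E + 1)) + 1 :=
    lt_of_le_of_lt (Nat.pow_le_pow_right two_pos (Nat.sub_le _ _)) (two_pow_qpExp_lt_modulus E n)
  simp only [smoothQPSimFn, Function.comp_apply, fanoutFn_apply, qpE_unary, qpM_unary, qpJ_unary,
    prodFn_boolPair, subFn_boolPair, bitsToNat_encodeNat]
  rw [modExpFn_boolPair hm, bitsToNat_encodeNat, bitsToNat_encodeNat, bitsToNat_encodeNat, ← pow_two,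
    Nat.mod_eq_of_lt hlt, smoothQPSim]

end Brick

/-- `n ↦ smoothQP E n` is polynomial-time computable from unary input to binary output. [folklore] -/
theorem polyTimeComputable_smoothQP (E : ℕ) :
    PolyTimeComputable unaryEncodeNat encodeNat (smoothQP E) := by
  have h := Brick.smoothQPFn_mem_FP E
  simp only [FP, Set.mem_setOf_eq] at h
  obtain ⟨p, M, hM⟩ := h
  refine ⟨p, M, fun n => ?_⟩
  have h1 := hM (unaryEncodeNat n)
  dsimp only at h1 ⊢
  rw [Brick.smoothQPFn_unary] at h1
  exact h1

/-- `n ↦ smoothQPSim E n` is polynomial-time computable from unary input to binary output.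
[folklore] -/
theorem polyTimeComputable_smoothQPSim (E : ℕ) :
    PolyTimeComputable unaryEncodeNat encodeNat (smoothQPSim E) := by
  have h := Brick.smoothQPSimFn_mem_FP E
  simp only [FP, Set.mem_setOf_eq] at h
  obtain ⟨p, M, hM⟩ := h
  refine ⟨p, M, fun n => ?_⟩
  have h1 := hM (unaryEncodeNat n)
  dsimp only at h1 ⊢
  rw [Brick.smoothQPSimFn_unary] at h1
  exact h1

/-- **`smoothQP E` is time constructible** (`1 ≤ E`) in the tree's Sipser form: `n ≤ g n`, and
`1ⁿ ↦ bin (g n)` is computed by a polynomial-time machine, whose running time is `≤ c · g n + c`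
(Arora–Barak 2009, §1.3: a function computable from `1ⁿ` in time `O(T(n))`, `T(n) ≥ n`, is time
constructible). [cite: AroraBarakCC2009, §1.3 (p. 16)] -/
theorem isTimeConstructible_smoothQP {E : ℕ} (hE : 1 ≤ E) : IsTimeConstructible (smoothQP E) := by
  refine ⟨le_smoothQP E, ?_⟩
  obtain ⟨p, M, hM⟩ := polyTimeComputable_smoothQP E
  obtain ⟨c, hc⟩ := exists_poly_le_smoothQP hE p
  refine ⟨c, M, fun n => (hM n).mono ?_⟩
  have hl : (unaryEncodeNat n).length = n := by
    rw [OracleCompose.unaryEncodeNat_eq_replicate, List.length_replicate]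
  simp only [hl]
  exact hc n

/-- **`smoothQPSim E` is time constructible** (`2 ≤ E`). [cite: AroraBarakCC2009, §1.3 (p. 16)] -/
theorem isTimeConstructible_smoothQPSim {E : ℕ} (hE : 2 ≤ E) :
    IsTimeConstructible (smoothQPSim E) := by
  refine ⟨le_smoothQPSim (by omega), ?_⟩
  obtain ⟨p, M, hM⟩ := polyTimeComputable_smoothQPSim E
  obtain ⟨c, hc⟩ := exists_poly_le_smoothQPSim hE p
  refine ⟨c, M, fun n => (hM n).mono ?_⟩
  have hl : (unaryEncodeNat n).length = n := by
    rw [OracleCompose.unaryEncodeNat_eq_replicate, List.length_replicate]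
  simp only [hl]
  exact hc n

end Literature.Computability.Complexity

end
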